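/-
Copyright (c) 2026 the pub-hodgecm-mathlib formalisation cell (harness21).  Prover seat hodgecm-mathlib-F0P2-p06 (g12): road «S3-ram» (LEAD F0P3a-plan (g12); architect
A-p16 (g31) 23:19:27Z deal G3 of F0P3a-p01 (g16)'s blueprint (a2)(B) «TREE INDUCTION» 899adc41; owner F0P3a-p06 (g15)), organ A′ (ii) (B4) «the LOCAL LAW AT A GENERAL
FIXED VERTEX»; 2026-09-01.
-/
import Literature.NumberTheory.Automorphic.UnitaryLatticeTreeFixedChildCountRamified   -- ★ p847085 (F0P2-p01 (g15)): the fixed-child count through `κ·N₁` AT THE ROOT, `ncard_fixed_children_of_congr{,_sq}`, `…_neighborSet_root_of_congr`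
import HarnessLib

/-!
# The lattice graph of a hermitian space — THE FIXED-CHILD COUNT AT A GENERAL VERTEX `u·L₀` of the tame-ramified `U(3)` tree: transport of the root law along `u`, and
# «the inward isotropic line of a fixed vertex is null» (Bruhat–Tits 1972 §10; Tits 1979 §3.5; Serre, *Trees* II.1.1; Kottwitz 1986 §3)

Topic `NumberTheory/Automorphic`; namespace `Literature.NumberTheory.Automorphic.UnitaryLatticeTree`.  THEOREMS ONLY (no definition, no instance, no notation, no named fact,
no `sorry`); kernel lane `--supports stmt-HodgeConjecture-24833`.  Cell `pub/hodgecm-mathlib` (D-0151), crux H413; road «S3-ram» (Literature seeding), organ A′ (ii) of the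
P-1-ram skeleton (architect A-p16 (g31)), gap **G3 = (B4)** of the blueprint «(a2)(B) TREE INDUCTION» (F0P3a-p01 (g16)): the inductive step of the fixed-subtree count is
run at EVERY fixed self-dual vertex, not only at the root `L₀ = 𝒪³`; this file moves the root law ★ `UnitaryLatticeTreeFixedChildCountRamified` (F0P2-p01 (g15)) to a
general self-dual vertex `u·L₀`, `u ∈ U(σ, J₀)(K)` (every self-dual vertex is of this form: ★ `exists_latticeGraphIso_root_eq_of_v_two` ∕ `…_of_trace`), by the one-line
dictionary ★ `mapGL_mapGL_eq_iff_mapGL_conj_eq`: **`γ` fixes `u·S` iff `γ′ := u⁻¹γu` fixes `S`**.  DATUM-FREE (`K` with `Valued K ℤᵐ⁰`, `σ` valuation-preserving with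
`σϖ = −ϖ` and residually trivial, finite residue field `𝓀`, `q = |𝓀|`; `J₀ = antidiag(1,1,1)`, `N₁ = latt diag(1,1,ϖ)`, `K₀ = U(σ,J₀) ∩ GL₃(𝒪)` = ★ `unitaryInt`).

THE MATHEMATICS.  Let `v = u·L₀` be a self-dual vertex and `γ ∈ U(σ,J₀)(K)` with `γ′ = u⁻¹γu ∈ K₀` (i.e. `γ` fixes `v`) and `γ′ ≡ 1 (mod ϖ)` («`γ` is deep at `v`», depth
label `d_v ≥ 1`).  The modular (type-two) neighbours of `v` are the `(uκ)·N₁`, `κ ∈ K₀` (§2, transport of ★ `star(L₀) = K₀·N₁`), all of them fixed by `γ` (§3); through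
`(uκ)·N₁` the `q` self-dual neighbours `w ≠ v` («children of `v` through that neighbour») are ALL fixed or NONE, according to the residual test
**`|ϖ⁻¹·B₀(x, (γ′ − 1)x)| < 1`, `x = κe₀`** — «the isotropic point `x̄` of the neighbour is `Q_Ȳ`-null, `Ȳ = (γ′ − 1)∕ϖ mod ϖ`» — so their number is `q·[test]` (§3, transport
of ★ `ncard_fixed_children_of_congr`), `= q` through every neighbour when `γ′ ≡ 1 (mod ϖ²)`.  Conversely (§4) **if ONE self-dual `w ≠ v` adjacent to `(uκ)·N₁` is fixed, the
test holds and ALL of them are fixed** — applied to the INWARD neighbour of a non-root fixed vertex (whose other side, the grand-parent, is fixed) this is the blueprint's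
«the inward isotropic line is always `Q_Ȳ`-null», whence the outward fixed grandchildren number `q·(ν − 1)`, `ν = #{modular neighbours passing the test}` (the
evaluation `ν ∈ {q+1, 2, 1}` by the residual type of `Ȳ` is the finite-geometry half ★ `OrthogonalThreeIsotropicPointsNilpotentForm`, not repeated here).

* §1 (any `N`, any form `H`) `latticeGraphIso_one_apply`, `latticeGraphIso_mul_apply`, `latticeGraphIso_mul_inv_apply`, `latticeGraphIso_inv_mul_apply`,
  **`mapGL_latticeGraphIso_eq_iff`** (`γ·(u·w) = u·w ↔ (u⁻¹γu)·w = w` on vertices), **`ncard_fixed_neighbors_latticeGraphIso_eq`** (the fixed part of a star, minus one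
  marked vertex, is transported by `u` with `γ ↦ uγu⁻¹`).
* §2 `mem_neighborSet_latticeGraphIso_root_iff` — `star(u·L₀) = {(uκ)·N₁ | κ ∈ K₀}`.
* §3 **`ncard_fixed_children_latticeGraphIso_of_congr'`** (`γ ∈ K₀` deep acting as `uγu⁻¹`), **`ncard_fixed_children_latticeGraphIso_of_congr`** (`γ` with `u⁻¹γu ∈ K₀`
  deep): `#{w ∈ star((uκ)·N₁) : w ≠ u·L₀, γ·w = w} = if |ϖ⁻¹B₀(κe₀,(γ′−1)κe₀)| < 1 then q else 0`; `…_of_congr_sq` (`= q`); `mapGL_mapGL_stdLattice_eq_of_conj_mem_unitaryInt`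
  (`γ` fixes `v`); `mapGL_eq_self_of_mem_neighborSet_latticeGraphIso_root_of_congr` + `ncard_fixed_neighborSet_latticeGraphIso_root_of_congr` (all `q + 1` modular
  neighbours of `v` are fixed).
* §4 **`v_B₀_lt_one_of_exists_fixed_child_latticeGraphIso_of_congr`** («one fixed child ⇒ the test holds» = «the inward line is null»),
  **`forall_mapGL_eq_self_of_exists_fixed_child_latticeGraphIso_of_congr`** («one fixed ⇒ all fixed» through a modular neighbour),
  `forall_mapGL_eq_self_or_forall_ne_latticeGraphIso_of_congr` (ALL-OR-NONE at a general vertex).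

HONEST LABEL: HC_CM is proved only modulo the 2 remaining named inputs (hLiu418 24832, h413 24833) until rung 0 closes; nothing printed is asserted here (elementary
lattice bookkeeping over a valuation ring, transport of ★ results); «S3-ram» has no books consequence.

## References
* [BruhatTits1972] F. Bruhat, J. Tits, *Groupes réductifs sur un corps local I*, Publ. Math. IHÉS 41 (1972), §10 (lattice models; the group acts on the building by
  type-preserving automorphisms; stars are residual buildings).
* [Tits1979] J. Tits, *Reductive groups over local fields*, PSPM 33.1 (1979), §2.4 (ramified `U(3)`: local index `(q+1, q+1)`), §3.5 (reduction mod `𝔭`; the first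
  congruence subgroup of a vertex stabiliser acts trivially on its star).
* [Serre1980Trees] J.-P. Serre, *Trees* (1980), Ch. II §1.1 (neighbours of a lattice = lines of its reduction; subtrees fixed by group elements).
* [Kottwitz1986] R. E. Kottwitz, *Base change for unit elements of Hecke algebras*, Compositio Math. 60 (1986), §3 (counting fixed lattices shell by shell from any
  fixed vertex).
-/

set_option autoImplicit false

noncomputable section

open scoped Valued WithZero Matrix MatrixGroups

namespace Literature.NumberTheory.Automorphic.UnitaryLatticeTree

open Literature.NumberTheory.Automorphic Literature.NumberTheory.Automorphic.HermitianLattice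

variable {K : Type*} [Field K] [Valued K ℤᵐ⁰] {σ : K →+* K} {ϖ : K}

/-! ## §1 Transport of fixed vertices along the action (any rank `N`, any form `H`) -/

section Transport

variable {N : ℕ} {H : Matrix (Fin N) (Fin N) K}

/-- `1 ∈ U(σ,H)` acts as the identity on vertices. [cite: BruhatTits1972, §10] -/
theorem latticeGraphIso_one_apply (v : {M : Submodule 𝒪[K] (Fin N → K) // IsVertex σ ϖ H M}) :
    latticeGraphIso σ ϖ H 1 v = v :=
  Subtype.ext (by rw [latticeGraphIso_apply_val, Subgroup.coe_one, mapGL_one])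

/-- The action is multiplicative on vertices: `(uκ)·v = u·(κ·v)`. [cite: BruhatTits1972, §10] -/
theorem latticeGraphIso_mul_apply (u κ : unitaryGroupOfForm σ H) (v : {M : Submodule 𝒪[K] (Fin N → K) // IsVertex σ ϖ H M}) :
    latticeGraphIso σ ϖ H (u * κ) v = latticeGraphIso σ ϖ H u (latticeGraphIso σ ϖ H κ v) :=
  Subtype.ext (by rw [latticeGraphIso_apply_val, latticeGraphIso_apply_val, latticeGraphIso_apply_val, Subgroup.coe_mul, mapGL_mul])

/-- `u·(u⁻¹·v) = v`. [cite: BruhatTits1972, §10] -/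
theorem latticeGraphIso_mul_inv_apply (u : unitaryGroupOfForm σ H) (v : {M : Submodule 𝒪[K] (Fin N → K) // IsVertex σ ϖ H M}) :
    latticeGraphIso σ ϖ H u (latticeGraphIso σ ϖ H u⁻¹ v) = v := by
  rw [← latticeGraphIso_mul_apply, mul_inv_cancel, latticeGraphIso_one_apply]

/-- `u⁻¹·(u·v) = v`. [cite: BruhatTits1972, §10] -/
theorem latticeGraphIso_inv_mul_apply (u : unitaryGroupOfForm σ H) (v : {M : Submodule 𝒪[K] (Fin N → K) // IsVertex σ ϖ H M}) :
    latticeGraphIso σ ϖ H u⁻¹ (latticeGraphIso σ ϖ H u v) = v := by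
  rw [← latticeGraphIso_mul_apply, inv_mul_cancel, latticeGraphIso_one_apply]

/-- **Fixed translates are translates of fixed points of the conjugate, vertex form**: `γ·(u·w) = u·w ↔ (u⁻¹γu)·w = w` (★ `mapGL_mapGL_eq_iff_mapGL_conj_eq` on the
underlying lattices). [cite: Serre1980Trees, II.1.1] [cite: BruhatTits1972, §10] -/
theorem mapGL_latticeGraphIso_eq_iff (γ u : unitaryGroupOfForm σ H) (w : {M : Submodule 𝒪[K] (Fin N → K) // IsVertex σ ϖ H M}) :
    mapGL (γ : GL (Fin N) K) (latticeGraphIso σ ϖ H u w).1 = (latticeGraphIso σ ϖ H u w).1 ↔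
      mapGL ((u⁻¹ * γ * u : unitaryGroupOfForm σ H) : GL (Fin N) K) w.1 = w.1 := by
  rw [latticeGraphIso_apply_val, mapGL_mapGL_eq_iff_mapGL_conj_eq, Subgroup.coe_mul, Subgroup.coe_mul, Subgroup.coe_inv]

/-- **The fixed part of a punctured star is transported by the action**: for a vertex `m`, a marked lattice `M` and `γ, u ∈ U(σ,H)`, the vertices `w` adjacent to `u·m`
with `w ≠ u·M` fixed by `uγu⁻¹` are the `u`-translates of the vertices adjacent to `m`, `≠ M`, fixed by `γ` — so the two sets have the same cardinality («read a fixed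
vertex `u·L₀` and its children at the root»). [cite: Serre1980Trees, II.1.1] [cite: BruhatTits1972, §10] [cite: Kottwitz1986, §3] -/
theorem ncard_fixed_neighbors_latticeGraphIso_eq (u γ : unitaryGroupOfForm σ H) (m : {M : Submodule 𝒪[K] (Fin N → K) // IsVertex σ ϖ H M})
    (M : Submodule 𝒪[K] (Fin N → K)) :
    {w : {M : Submodule 𝒪[K] (Fin N → K) // IsVertex σ ϖ H M} | w ∈ (latticeGraph σ ϖ H).neighborSet (latticeGraphIso σ ϖ H u m) ∧
        w.1 ≠ mapGL (u : GL (Fin N) K) M ∧ mapGL ((u * γ * u⁻¹ : unitaryGroupOfForm σ H) : GL (Fin N) K) w.1 = w.1}.ncard =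
      {w : {M : Submodule 𝒪[K] (Fin N → K) // IsVertex σ ϖ H M} | w ∈ (latticeGraph σ ϖ H).neighborSet m ∧
        w.1 ≠ M ∧ mapGL (γ : GL (Fin N) K) w.1 = w.1}.ncard := by
  have himage : {w : {M : Submodule 𝒪[K] (Fin N → K) // IsVertex σ ϖ H M} | w ∈ (latticeGraph σ ϖ H).neighborSet (latticeGraphIso σ ϖ H u m) ∧
        w.1 ≠ mapGL (u : GL (Fin N) K) M ∧ mapGL ((u * γ * u⁻¹ : unitaryGroupOfForm σ H) : GL (Fin N) K) w.1 = w.1} =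
      latticeGraphIso σ ϖ H u '' {w : {M : Submodule 𝒪[K] (Fin N → K) // IsVertex σ ϖ H M} | w ∈ (latticeGraph σ ϖ H).neighborSet m ∧
        w.1 ≠ M ∧ mapGL (γ : GL (Fin N) K) w.1 = w.1} := by
    ext w
    simp only [Set.mem_setOf_eq, Set.mem_image, SimpleGraph.mem_neighborSet]
    constructor
    · rintro ⟨hadj, hne, hfix⟩
      have hw : latticeGraphIso σ ϖ H u (latticeGraphIso σ ϖ H u⁻¹ w) = w := latticeGraphIso_mul_inv_apply u w
      refine ⟨latticeGraphIso σ ϖ H u⁻¹ w, ⟨?_, ?_, ?_⟩, hw⟩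
      · rw [← hw] at hadj
        exact (latticeGraphIso σ ϖ H u).map_adj_iff.1 hadj
      · intro heq
        apply hne
        rw [← hw, latticeGraphIso_apply_val, heq]
      · rw [mapGL_latticeGraphIso_eq_iff, inv_inv]
        exact hfix
    · rintro ⟨w', ⟨hadj', hne', hfix'⟩, rfl⟩
      refine ⟨(latticeGraphIso σ ϖ H u).map_adj_iff.2 hadj', fun heq => hne' ?_, ?_⟩
      · rw [latticeGraphIso_apply_val] at heq
        exact mapGL_injective _ heq
      · rw [mapGL_latticeGraphIso_eq_iff]
        have e : u⁻¹ * (u * γ * u⁻¹) * u = γ := by group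
        rw [e]
        exact hfix'
  rw [himage, Set.ncard_image_of_injective _ (latticeGraphIso σ ϖ H u).injective]

end Transport

/-! ## §2 The star of a general self-dual vertex `u·L₀` of `(K³, J₀)` -/

/-- **`star(u·L₀) = {(uκ)·N₁ | κ ∈ K₀}`**: the neighbours of the self-dual vertex `u·L₀` are the `u`-translates of the neighbours `κ·N₁` of the root (★
`mem_neighborSet_root_iff_exists_mem_unitaryInt_of_trace`; `|2| = 1` supplies the trace element `½`). [cite: BruhatTits1972, (4.4.4) and §10] [cite: Tits1979, §3.5] -/
theorem mem_neighborSet_latticeGraphIso_root_iff (hσ : ∀ x, σ (σ x) = x) (hvσ : ∀ a, Valued.v (σ a) = Valued.v a) (hσϖ : σ ϖ = -ϖ)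
    (hϖ : Valued.v ϖ = WithZero.exp (-1 : ℤ)) (h2 : Valued.v (2 : K) = 1)
    (u : unitaryGroupOfForm σ ((StdForm.antidiagonal 3).over K))
    (m : {M : Submodule 𝒪[K] (Fin 3 → K) // IsVertex σ ϖ ((StdForm.antidiagonal 3).over K) M}) :
    m ∈ (latticeGraph σ ϖ ((StdForm.antidiagonal 3).over K)).neighborSet
        (latticeGraphIso σ ϖ ((StdForm.antidiagonal 3).over K) u ⟨stdLattice K 3, 0, isSelfDualLattice_stdLattice_three_of_v hϖ⟩) ↔
      ∃ κ : unitaryGroupOfForm σ ((StdForm.antidiagonal 3).over K), κ ∈ unitaryInt σ ((StdForm.antidiagonal 3).over K) ∧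
        m = latticeGraphIso σ ϖ ((StdForm.antidiagonal 3).over K) (u * κ) ⟨latt (Matrix.diagonal ![(1 : K), 1, ϖ]), 2, isVertexLattice_two_N₁_of_neg hσϖ hϖ⟩ := by
  have h20 : (2 : K) ≠ 0 := fun h => by rw [h, map_zero] at h2; exact zero_ne_one h2
  have htrace : ∃ t : K, Valued.v t ≤ 1 ∧ t + σ t = 1 :=
    ⟨2⁻¹, by rw [map_inv₀, h2, inv_one], by rw [map_inv₀, map_ofNat]; field_simp; norm_num⟩
  constructor
  · intro hm
    have hw : latticeGraphIso σ ϖ ((StdForm.antidiagonal 3).over K) u (latticeGraphIso σ ϖ ((StdForm.antidiagonal 3).over K) u⁻¹ m) = m :=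
      latticeGraphIso_mul_inv_apply u m
    have hm' : latticeGraphIso σ ϖ ((StdForm.antidiagonal 3).over K) u⁻¹ m ∈
        (latticeGraph σ ϖ ((StdForm.antidiagonal 3).over K)).neighborSet ⟨stdLattice K 3, 0, isSelfDualLattice_stdLattice_three_of_v hϖ⟩ := by
      rw [SimpleGraph.mem_neighborSet] at hm ⊢
      rw [← hw] at hm
      exact (latticeGraphIso σ ϖ ((StdForm.antidiagonal 3).over K) u).map_adj_iff.1 hm
    obtain ⟨κ, hκ, hκm⟩ := (mem_neighborSet_root_iff_exists_mem_unitaryInt_of_trace hσ hvσ hϖ htrace (isVertexLattice_two_N₁_of_neg hσϖ hϖ) _).1 hm'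
    refine ⟨κ, hκ, ?_⟩
    have e : latticeGraphIso σ ϖ ((StdForm.antidiagonal 3).over K) κ ⟨latt (Matrix.diagonal ![(1 : K), 1, ϖ]), 2, isVertexLattice_two_N₁_of_neg hσϖ hϖ⟩ =
        latticeGraphIso σ ϖ ((StdForm.antidiagonal 3).over K) u⁻¹ m :=
      Subtype.ext (by rw [latticeGraphIso_apply_val]; exact hκm.symm)
    rw [latticeGraphIso_mul_apply, e, hw]
  · rintro ⟨κ, hκ, rfl⟩
    rw [SimpleGraph.mem_neighborSet, latticeGraphIso_mul_apply]
    exact (latticeGraphIso σ ϖ ((StdForm.antidiagonal 3).over K) u).map_adj_iff.2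
      ((mem_neighborSet_root_iff_exists_mem_unitaryInt_of_trace hσ hvσ hϖ htrace (isVertexLattice_two_N₁_of_neg hσϖ hϖ) _).2 ⟨κ, hκ, rfl⟩)

/-! ## §3 The fixed-child count through a modular neighbour `(uκ)·N₁` of `u·L₀` -/

/-- **THE FIXED-CHILD COUNT AT A GENERAL VERTEX, `γ′`-form**: for `γ ∈ K₀` with `γ ≡ 1 (mod ϖ)`, `κ ∈ K₀` and any `u ∈ U(σ,J₀)(K)`, the number of self-dual neighbours
`w ≠ u·L₀` of `(uκ)·N₁` fixed by `uγu⁻¹` is `q` if `|ϖ⁻¹·B₀(x, (γ − 1)x)| < 1` (`x = κe₀`) and `0` otherwise (★ `ncard_fixed_children_of_congr` transported by §1).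
[cite: Tits1979, §2.4, §3.5] [cite: BruhatTits1972, §10] [cite: Kottwitz1986, §3] -/
theorem ncard_fixed_children_latticeGraphIso_of_congr' (hvσ : ∀ a, Valued.v (σ a) = Valued.v a) (hσϖ : σ ϖ = -ϖ) (hϖ : Valued.v ϖ = WithZero.exp (-1 : ℤ))
    (hres : ∀ x : K, Valued.v x ≤ 1 → Valued.v (σ x - x) < 1) [Finite 𝓀[K]]
    (u : unitaryGroupOfForm σ ((StdForm.antidiagonal 3).over K)) {γ κ : unitaryGroupOfForm σ ((StdForm.antidiagonal 3).over K)}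
    (hγK : γ ∈ unitaryInt σ ((StdForm.antidiagonal 3).over K)) (hκK : κ ∈ unitaryInt σ ((StdForm.antidiagonal 3).over K))
    (hγϖ : ∀ i j, Valued.v ((((γ : GL (Fin 3) K) : Matrix (Fin 3) (Fin 3) K) - 1) i j) ≤ Valued.v ϖ) :
    {w | w ∈ (latticeGraph σ ϖ ((StdForm.antidiagonal 3).over K)).neighborSet
          (latticeGraphIso σ ϖ ((StdForm.antidiagonal 3).over K) (u * κ) ⟨latt (Matrix.diagonal ![(1 : K), 1, ϖ]), 2, isVertexLattice_two_N₁_of_neg hσϖ hϖ⟩) ∧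
        w.1 ≠ mapGL (u : GL (Fin 3) K) (stdLattice K 3) ∧
        mapGL ((u * γ * u⁻¹ : unitaryGroupOfForm σ ((StdForm.antidiagonal 3).over K)) : GL (Fin 3) K) w.1 = w.1}.ncard =
      if Valued.v (ϖ⁻¹ * B₀ σ 3 (fun i => ((κ : GL (Fin 3) K) : Matrix (Fin 3) (Fin 3) K) i 0)
          ((((γ : GL (Fin 3) K) : Matrix (Fin 3) (Fin 3) K) - 1).mulVec (fun i => ((κ : GL (Fin 3) K) : Matrix (Fin 3) (Fin 3) K) i 0))) < 1 then Nat.card 𝓀[K] else 0 := by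
  rw [latticeGraphIso_mul_apply, ncard_fixed_neighbors_latticeGraphIso_eq]
  exact ncard_fixed_children_of_congr hvσ hσϖ hϖ hres hγK hκK hγϖ

/-- **THE FIXED-CHILD COUNT AT A GENERAL VERTEX** `v = u·L₀`: for `γ ∈ U(σ,J₀)(K)` with `γ′ := u⁻¹γu ∈ K₀` (`γ` fixes `v`) and `γ′ ≡ 1 (mod ϖ)` (`γ` deep at `v`), and a
modular neighbour `(uκ)·N₁` of `v` (`κ ∈ K₀`, §2): **`#{w ∈ star((uκ)·N₁) : w ≠ v, γ·w = w} = if |ϖ⁻¹·B₀(x, (γ′ − 1)x)| < 1 then q else 0`**, `x = κe₀` — the children of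
`v` through that neighbour are all fixed or none, by the residual test read ON THE CONJUGATE `γ′` («at the root»). [cite: Tits1979, §2.4, §3.5] [cite: BruhatTits1972, §10]
[cite: Serre1980Trees, II.1.1] [cite: Kottwitz1986, §3] -/
theorem ncard_fixed_children_latticeGraphIso_of_congr (hvσ : ∀ a, Valued.v (σ a) = Valued.v a) (hσϖ : σ ϖ = -ϖ) (hϖ : Valued.v ϖ = WithZero.exp (-1 : ℤ))
    (hres : ∀ x : K, Valued.v x ≤ 1 → Valued.v (σ x - x) < 1) [Finite 𝓀[K]]
    {γ u κ : unitaryGroupOfForm σ ((StdForm.antidiagonal 3).over K)}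
    (hγK : u⁻¹ * γ * u ∈ unitaryInt σ ((StdForm.antidiagonal 3).over K)) (hκK : κ ∈ unitaryInt σ ((StdForm.antidiagonal 3).over K))
    (hγϖ : ∀ i j, Valued.v (((((u⁻¹ * γ * u : unitaryGroupOfForm σ ((StdForm.antidiagonal 3).over K)) : GL (Fin 3) K) : Matrix (Fin 3) (Fin 3) K) - 1) i j) ≤ Valued.v ϖ) :
    {w | w ∈ (latticeGraph σ ϖ ((StdForm.antidiagonal 3).over K)).neighborSet
          (latticeGraphIso σ ϖ ((StdForm.antidiagonal 3).over K) (u * κ) ⟨latt (Matrix.diagonal ![(1 : K), 1, ϖ]), 2, isVertexLattice_two_N₁_of_neg hσϖ hϖ⟩) ∧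
        w.1 ≠ mapGL (u : GL (Fin 3) K) (stdLattice K 3) ∧ mapGL (γ : GL (Fin 3) K) w.1 = w.1}.ncard =
      if Valued.v (ϖ⁻¹ * B₀ σ 3 (fun i => ((κ : GL (Fin 3) K) : Matrix (Fin 3) (Fin 3) K) i 0)
          (((((u⁻¹ * γ * u : unitaryGroupOfForm σ ((StdForm.antidiagonal 3).over K)) : GL (Fin 3) K) : Matrix (Fin 3) (Fin 3) K) - 1).mulVec
            (fun i => ((κ : GL (Fin 3) K) : Matrix (Fin 3) (Fin 3) K) i 0))) < 1 then Nat.card 𝓀[K] else 0 := by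
  have h := ncard_fixed_children_latticeGraphIso_of_congr' hvσ hσϖ hϖ hres u hγK hκK hγϖ
  have e : u * (u⁻¹ * γ * u) * u⁻¹ = γ := by group
  rw [e] at h
  exact h

/-- **A 2-deep element fixes all `q` children through every modular neighbour of `v = u·L₀`** (`γ′ = u⁻¹γu ≡ 1 (mod ϖ²)`, «interior vertices have all `q²` grandchildren
fixed»; ★ `ncard_fixed_children_of_congr_sq` transported). [cite: Tits1979, §3.5] [cite: Kottwitz1986, §3] -/
theorem ncard_fixed_children_latticeGraphIso_of_congr_sq (hvσ : ∀ a, Valued.v (σ a) = Valued.v a) (hσϖ : σ ϖ = -ϖ) (hϖ : Valued.v ϖ = WithZero.exp (-1 : ℤ))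
    (hres : ∀ x : K, Valued.v x ≤ 1 → Valued.v (σ x - x) < 1) [Finite 𝓀[K]]
    {γ u κ : unitaryGroupOfForm σ ((StdForm.antidiagonal 3).over K)}
    (hγK : u⁻¹ * γ * u ∈ unitaryInt σ ((StdForm.antidiagonal 3).over K)) (hκK : κ ∈ unitaryInt σ ((StdForm.antidiagonal 3).over K))
    (hγϖ2 : ∀ i j, Valued.v (((((u⁻¹ * γ * u : unitaryGroupOfForm σ ((StdForm.antidiagonal 3).over K)) : GL (Fin 3) K) : Matrix (Fin 3) (Fin 3) K) - 1) i j) ≤ Valued.v ϖ ^ 2) :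
    {w | w ∈ (latticeGraph σ ϖ ((StdForm.antidiagonal 3).over K)).neighborSet
          (latticeGraphIso σ ϖ ((StdForm.antidiagonal 3).over K) (u * κ) ⟨latt (Matrix.diagonal ![(1 : K), 1, ϖ]), 2, isVertexLattice_two_N₁_of_neg hσϖ hϖ⟩) ∧
        w.1 ≠ mapGL (u : GL (Fin 3) K) (stdLattice K 3) ∧ mapGL (γ : GL (Fin 3) K) w.1 = w.1}.ncard = Nat.card 𝓀[K] := by
  have h : {w | w ∈ (latticeGraph σ ϖ ((StdForm.antidiagonal 3).over K)).neighborSet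
          (latticeGraphIso σ ϖ ((StdForm.antidiagonal 3).over K) (u * κ) ⟨latt (Matrix.diagonal ![(1 : K), 1, ϖ]), 2, isVertexLattice_two_N₁_of_neg hσϖ hϖ⟩) ∧
        w.1 ≠ mapGL (u : GL (Fin 3) K) (stdLattice K 3) ∧
        mapGL ((u * (u⁻¹ * γ * u) * u⁻¹ : unitaryGroupOfForm σ ((StdForm.antidiagonal 3).over K)) : GL (Fin 3) K) w.1 = w.1}.ncard = Nat.card 𝓀[K] := by
    rw [latticeGraphIso_mul_apply, ncard_fixed_neighbors_latticeGraphIso_eq]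
    exact ncard_fixed_children_of_congr_sq hvσ hσϖ hϖ hres hγK hκK hγϖ2
  have e : u * (u⁻¹ * γ * u) * u⁻¹ = γ := by group
  rw [e] at h
  exact h

/-- **`γ` fixes `v = u·L₀` when `u⁻¹γu ∈ K₀`** (★ `mapGL_stdLattice_of_mem_unitaryInt` transported). [cite: BruhatTits1972, §10] [cite: Serre1980Trees, II.1.1] -/
theorem mapGL_mapGL_stdLattice_eq_of_conj_mem_unitaryInt {N : ℕ} {H : Matrix (Fin N) (Fin N) K} {γ u : unitaryGroupOfForm σ H}
    (hγK : u⁻¹ * γ * u ∈ unitaryInt σ H) :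
    mapGL (γ : GL (Fin N) K) (mapGL (u : GL (Fin N) K) (stdLattice K N)) = mapGL (u : GL (Fin N) K) (stdLattice K N) := by
  rw [mapGL_mapGL_eq_iff_mapGL_conj_eq]
  have e : (u : GL (Fin N) K)⁻¹ * (γ : GL (Fin N) K) * (u : GL (Fin N) K) = ((u⁻¹ * γ * u : unitaryGroupOfForm σ H) : GL (Fin N) K) := by
    rw [Subgroup.coe_mul, Subgroup.coe_mul, Subgroup.coe_inv]
  rw [e]
  exact mapGL_stdLattice_of_mem_unitaryInt hγK

/-- **A deep `γ` fixes every (modular) neighbour of `v = u·L₀`** (`u⁻¹γu ∈ K₀`, `≡ 1 (mod ϖ)` entrywise in the strict sense `< 1`; ★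
`mapGL_eq_self_of_mem_neighborSet_root_of_congr` transported). [cite: Tits1979, §3.5] [cite: Serre1980Trees, II.1.1] -/
theorem mapGL_eq_self_of_mem_neighborSet_latticeGraphIso_root_of_congr (hσ : ∀ x, σ (σ x) = x) (hvσ : ∀ a, Valued.v (σ a) = Valued.v a) (hσϖ : σ ϖ = -ϖ)
    (hϖ : Valued.v ϖ = WithZero.exp (-1 : ℤ)) (h2 : Valued.v (2 : K) = 1)
    {γ u : unitaryGroupOfForm σ ((StdForm.antidiagonal 3).over K)} (hγK : u⁻¹ * γ * u ∈ unitaryInt σ ((StdForm.antidiagonal 3).over K))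
    (hγ1 : ∀ i j, Valued.v (((((u⁻¹ * γ * u : unitaryGroupOfForm σ ((StdForm.antidiagonal 3).over K)) : GL (Fin 3) K) : Matrix (Fin 3) (Fin 3) K) - 1) i j) < 1)
    {w : {M : Submodule 𝒪[K] (Fin 3 → K) // IsVertex σ ϖ ((StdForm.antidiagonal 3).over K) M}}
    (hw : w ∈ (latticeGraph σ ϖ ((StdForm.antidiagonal 3).over K)).neighborSet
        (latticeGraphIso σ ϖ ((StdForm.antidiagonal 3).over K) u ⟨stdLattice K 3, 0, isSelfDualLattice_stdLattice_three_of_v hϖ⟩)) :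
    mapGL (γ : GL (Fin 3) K) w.1 = w.1 := by
  have hw' := hw
  have hwu : latticeGraphIso σ ϖ ((StdForm.antidiagonal 3).over K) u (latticeGraphIso σ ϖ ((StdForm.antidiagonal 3).over K) u⁻¹ w) = w :=
    latticeGraphIso_mul_inv_apply u w
  rw [SimpleGraph.mem_neighborSet, ← hwu] at hw'
  have hadj := (latticeGraphIso σ ϖ ((StdForm.antidiagonal 3).over K) u).map_adj_iff.1 hw'
  have hfix := mapGL_eq_self_of_mem_neighborSet_root_of_congr hσ hvσ hσϖ hϖ h2 hγK hγ1 ((SimpleGraph.mem_neighborSet _ _ _).2 hadj)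
  rw [← hwu, mapGL_latticeGraphIso_eq_iff]
  exact hfix

/-- **THE FIXED STAR OF `v = u·L₀` FOR A DEEP `γ` has all `q + 1` modular neighbours** (★ `ncard_neighborSet_of_isSelfDualLattice_of_ramified` ∕ `ncard_neighborSet_latticeGraphIso`).
[cite: Tits1979, §2.4, §3.5] [cite: Serre1980Trees, II.1.1] -/
theorem ncard_fixed_neighborSet_latticeGraphIso_root_of_congr (hσ : ∀ x, σ (σ x) = x) (hvσ : ∀ a, Valued.v (σ a) = Valued.v a) (hσϖ : σ ϖ = -ϖ)
    (hϖ : Valued.v ϖ = WithZero.exp (-1 : ℤ)) (hres : ∀ x : K, Valued.v x ≤ 1 → Valued.v (σ x - x) < 1) (h2 : Valued.v (2 : K) = 1) [Finite 𝓀[K]]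
    {γ u : unitaryGroupOfForm σ ((StdForm.antidiagonal 3).over K)} (hγK : u⁻¹ * γ * u ∈ unitaryInt σ ((StdForm.antidiagonal 3).over K))
    (hγ1 : ∀ i j, Valued.v (((((u⁻¹ * γ * u : unitaryGroupOfForm σ ((StdForm.antidiagonal 3).over K)) : GL (Fin 3) K) : Matrix (Fin 3) (Fin 3) K) - 1) i j) < 1) :
    {w | w ∈ (latticeGraph σ ϖ ((StdForm.antidiagonal 3).over K)).neighborSet
          (latticeGraphIso σ ϖ ((StdForm.antidiagonal 3).over K) u ⟨stdLattice K 3, 0, isSelfDualLattice_stdLattice_three_of_v hϖ⟩) ∧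
        mapGL (γ : GL (Fin 3) K) w.1 = w.1}.ncard = Nat.card 𝓀[K] + 1 := by
  have hset : {w | w ∈ (latticeGraph σ ϖ ((StdForm.antidiagonal 3).over K)).neighborSet
          (latticeGraphIso σ ϖ ((StdForm.antidiagonal 3).over K) u ⟨stdLattice K 3, 0, isSelfDualLattice_stdLattice_three_of_v hϖ⟩) ∧
        mapGL (γ : GL (Fin 3) K) w.1 = w.1} =
      (latticeGraph σ ϖ ((StdForm.antidiagonal 3).over K)).neighborSet
          (latticeGraphIso σ ϖ ((StdForm.antidiagonal 3).over K) u ⟨stdLattice K 3, 0, isSelfDualLattice_stdLattice_three_of_v hϖ⟩) := by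
    ext w
    simp only [Set.mem_setOf_eq]
    exact ⟨fun h => h.1, fun h => ⟨h, mapGL_eq_self_of_mem_neighborSet_latticeGraphIso_root_of_congr hσ hvσ hσϖ hϖ h2 hγK hγ1 h⟩⟩
  rw [hset, ncard_neighborSet_latticeGraphIso]
  exact ncard_neighborSet_root_of_ramified hσ hvσ hϖ hres h2 (isVertexLattice_two_N₁_of_neg hσϖ hϖ)

/-! ## §4 «One fixed child ⇒ the test holds ⇒ all children fixed»: the inward isotropic line of a fixed vertex is null -/

/-- **ONE FIXED CHILD FORCES THE RESIDUAL TEST** («the inward isotropic line of a non-root fixed vertex is `Q_Ȳ`-null»): at `v = u·L₀` with `γ′ = u⁻¹γu ∈ K₀` deep, if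
SOME self-dual `w ≠ v` adjacent to the modular neighbour `(uκ)·N₁` is fixed by `γ`, then `|ϖ⁻¹·B₀(x, (γ′ − 1)x)| < 1`, `x = κe₀` (else §3 counts `0` fixed children in a
finite star).  In the rooted tree this is applied to the INWARD neighbour of `v`, whose other self-dual side — the grand-parent of `v` — is fixed. [cite: Tits1979, §3.5]
[cite: Serre1980Trees, II.1.1] [cite: Kottwitz1986, §3] -/
theorem v_B₀_lt_one_of_exists_fixed_child_latticeGraphIso_of_congr (hvσ : ∀ a, Valued.v (σ a) = Valued.v a) (hσϖ : σ ϖ = -ϖ) (hϖ : Valued.v ϖ = WithZero.exp (-1 : ℤ))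
    (hres : ∀ x : K, Valued.v x ≤ 1 → Valued.v (σ x - x) < 1) [Finite 𝓀[K]]
    {γ u κ : unitaryGroupOfForm σ ((StdForm.antidiagonal 3).over K)}
    (hγK : u⁻¹ * γ * u ∈ unitaryInt σ ((StdForm.antidiagonal 3).over K)) (hκK : κ ∈ unitaryInt σ ((StdForm.antidiagonal 3).over K))
    (hγϖ : ∀ i j, Valued.v (((((u⁻¹ * γ * u : unitaryGroupOfForm σ ((StdForm.antidiagonal 3).over K)) : GL (Fin 3) K) : Matrix (Fin 3) (Fin 3) K) - 1) i j) ≤ Valued.v ϖ)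
    (hex : ∃ w ∈ (latticeGraph σ ϖ ((StdForm.antidiagonal 3).over K)).neighborSet
          (latticeGraphIso σ ϖ ((StdForm.antidiagonal 3).over K) (u * κ) ⟨latt (Matrix.diagonal ![(1 : K), 1, ϖ]), 2, isVertexLattice_two_N₁_of_neg hσϖ hϖ⟩),
        w.1 ≠ mapGL (u : GL (Fin 3) K) (stdLattice K 3) ∧ mapGL (γ : GL (Fin 3) K) w.1 = w.1) :
    Valued.v (ϖ⁻¹ * B₀ σ 3 (fun i => ((κ : GL (Fin 3) K) : Matrix (Fin 3) (Fin 3) K) i 0)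
        (((((u⁻¹ * γ * u : unitaryGroupOfForm σ ((StdForm.antidiagonal 3).over K)) : GL (Fin 3) K) : Matrix (Fin 3) (Fin 3) K) - 1).mulVec
          (fun i => ((κ : GL (Fin 3) K) : Matrix (Fin 3) (Fin 3) K) i 0))) < 1 := by
  by_contra hc
  have h := ncard_fixed_children_latticeGraphIso_of_congr hvσ hσϖ hϖ hres hγK hκK hγϖ
  rw [if_neg hc] at h
  -- the fixed-children set is finite (it sits in a star of `q + 1` vertices) and nonempty: contradiction
  have hstar : ((latticeGraph σ ϖ ((StdForm.antidiagonal 3).over K)).neighborSet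
      (latticeGraphIso σ ϖ ((StdForm.antidiagonal 3).over K) (u * κ) ⟨latt (Matrix.diagonal ![(1 : K), 1, ϖ]), 2, isVertexLattice_two_N₁_of_neg hσϖ hϖ⟩)).ncard =
      Nat.card 𝓀[K] + 1 := by
    rw [ncard_neighborSet_latticeGraphIso]; exact ncard_neighborSet_N₁_of_neg hvσ hσϖ hϖ hres
  have hfin : ((latticeGraph σ ϖ ((StdForm.antidiagonal 3).over K)).neighborSet
      (latticeGraphIso σ ϖ ((StdForm.antidiagonal 3).over K) (u * κ) ⟨latt (Matrix.diagonal ![(1 : K), 1, ϖ]), 2, isVertexLattice_two_N₁_of_neg hσϖ hϖ⟩)).Finite :=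
    Set.finite_of_ncard_ne_zero (by rw [hstar]; exact Nat.succ_ne_zero _)
  obtain ⟨w, hw, hne, hfix⟩ := hex
  have hmem : w ∈ {w | w ∈ (latticeGraph σ ϖ ((StdForm.antidiagonal 3).over K)).neighborSet
          (latticeGraphIso σ ϖ ((StdForm.antidiagonal 3).over K) (u * κ) ⟨latt (Matrix.diagonal ![(1 : K), 1, ϖ]), 2, isVertexLattice_two_N₁_of_neg hσϖ hϖ⟩) ∧
        w.1 ≠ mapGL (u : GL (Fin 3) K) (stdLattice K 3) ∧ mapGL (γ : GL (Fin 3) K) w.1 = w.1} := ⟨hw, hne, hfix⟩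
  have hempty : {w | w ∈ (latticeGraph σ ϖ ((StdForm.antidiagonal 3).over K)).neighborSet
          (latticeGraphIso σ ϖ ((StdForm.antidiagonal 3).over K) (u * κ) ⟨latt (Matrix.diagonal ![(1 : K), 1, ϖ]), 2, isVertexLattice_two_N₁_of_neg hσϖ hϖ⟩) ∧
        w.1 ≠ mapGL (u : GL (Fin 3) K) (stdLattice K 3) ∧ mapGL (γ : GL (Fin 3) K) w.1 = w.1} = ∅ :=
    (Set.ncard_eq_zero (hfin.subset fun x hx => hx.1)).1 h
  rw [hempty] at hmem
  simp only [Set.mem_empty_iff_false] at hmem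

/-- **ONE FIXED ⇒ ALL FIXED through a modular neighbour**: at `v = u·L₀` with `γ′ = u⁻¹γu ∈ K₀` deep, if some self-dual `w₀ ≠ v` adjacent to `(uκ)·N₁` is fixed by `γ`
then EVERY vertex adjacent to `(uκ)·N₁` is fixed by `γ` (`v` itself by §3, the `q` others by the count `q` of §3 under the test of the previous theorem).  Rooted
reading: the siblings of a deep fixed vertex are fixed. [cite: Tits1979, §3.5] [cite: Serre1980Trees, II.1.1] [cite: Kottwitz1986, §3] -/
theorem forall_mapGL_eq_self_of_exists_fixed_child_latticeGraphIso_of_congr (hvσ : ∀ a, Valued.v (σ a) = Valued.v a) (hσϖ : σ ϖ = -ϖ)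
    (hϖ : Valued.v ϖ = WithZero.exp (-1 : ℤ)) (hres : ∀ x : K, Valued.v x ≤ 1 → Valued.v (σ x - x) < 1) [Finite 𝓀[K]]
    {γ u κ : unitaryGroupOfForm σ ((StdForm.antidiagonal 3).over K)}
    (hγK : u⁻¹ * γ * u ∈ unitaryInt σ ((StdForm.antidiagonal 3).over K)) (hκK : κ ∈ unitaryInt σ ((StdForm.antidiagonal 3).over K))
    (hγϖ : ∀ i j, Valued.v (((((u⁻¹ * γ * u : unitaryGroupOfForm σ ((StdForm.antidiagonal 3).over K)) : GL (Fin 3) K) : Matrix (Fin 3) (Fin 3) K) - 1) i j) ≤ Valued.v ϖ)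
    (hex : ∃ w ∈ (latticeGraph σ ϖ ((StdForm.antidiagonal 3).over K)).neighborSet
          (latticeGraphIso σ ϖ ((StdForm.antidiagonal 3).over K) (u * κ) ⟨latt (Matrix.diagonal ![(1 : K), 1, ϖ]), 2, isVertexLattice_two_N₁_of_neg hσϖ hϖ⟩),
        w.1 ≠ mapGL (u : GL (Fin 3) K) (stdLattice K 3) ∧ mapGL (γ : GL (Fin 3) K) w.1 = w.1)
    {w : {M : Submodule 𝒪[K] (Fin 3 → K) // IsVertex σ ϖ ((StdForm.antidiagonal 3).over K) M}}
    (hw : w ∈ (latticeGraph σ ϖ ((StdForm.antidiagonal 3).over K)).neighborSet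
          (latticeGraphIso σ ϖ ((StdForm.antidiagonal 3).over K) (u * κ) ⟨latt (Matrix.diagonal ![(1 : K), 1, ϖ]), 2, isVertexLattice_two_N₁_of_neg hσϖ hϖ⟩)) :
    mapGL (γ : GL (Fin 3) K) w.1 = w.1 := by
  classical
  by_cases hwv : w.1 = mapGL (u : GL (Fin 3) K) (stdLattice K 3)
  · rw [hwv]; exact mapGL_mapGL_stdLattice_eq_of_conj_mem_unitaryInt hγK
  · -- the fixed children are `q` of the `q` children: all of them
    have htest := v_B₀_lt_one_of_exists_fixed_child_latticeGraphIso_of_congr hvσ hσϖ hϖ hres hγK hκK hγϖ hex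
    have hcount := ncard_fixed_children_latticeGraphIso_of_congr hvσ hσϖ hϖ hres hγK hκK hγϖ
    rw [if_pos htest] at hcount
    -- the punctured star has `q` elements
    set S := (latticeGraph σ ϖ ((StdForm.antidiagonal 3).over K)).neighborSet
      (latticeGraphIso σ ϖ ((StdForm.antidiagonal 3).over K) (u * κ) ⟨latt (Matrix.diagonal ![(1 : K), 1, ϖ]), 2, isVertexLattice_two_N₁_of_neg hσϖ hϖ⟩) with hS
    have hstar : S.ncard = Nat.card 𝓀[K] + 1 := by
      rw [hS, ncard_neighborSet_latticeGraphIso]; exact ncard_neighborSet_N₁_of_neg hvσ hσϖ hϖ hres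
    have hfin : S.Finite := Set.finite_of_ncard_ne_zero (by rw [hstar]; exact Nat.succ_ne_zero _)
    have hvmem : latticeGraphIso σ ϖ ((StdForm.antidiagonal 3).over K) u ⟨stdLattice K 3, 0, isSelfDualLattice_stdLattice_three_of_v hϖ⟩ ∈ S := by
      have hL : latticeGraphIso σ ϖ ((StdForm.antidiagonal 3).over K) κ ⟨stdLattice K 3, 0, isSelfDualLattice_stdLattice_three_of_v hϖ⟩ =
          ⟨stdLattice K 3, 0, isSelfDualLattice_stdLattice_three_of_v hϖ⟩ :=
        Subtype.ext (by rw [latticeGraphIso_apply_val]; exact mapGL_stdLattice_of_mem_unitaryInt hκK)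
      rw [hS, SimpleGraph.mem_neighborSet, latticeGraphIso_mul_apply, ← hL]
      exact (latticeGraphIso σ ϖ ((StdForm.antidiagonal 3).over K) u).map_adj_iff.2
        ((latticeGraphIso σ ϖ ((StdForm.antidiagonal 3).over K) κ).map_adj_iff.2 (stdLattice_mem_neighborSet_N₁_of_neg hvσ hσϖ hϖ))
    have hpunct : (S \ {latticeGraphIso σ ϖ ((StdForm.antidiagonal 3).over K) u ⟨stdLattice K 3, 0, isSelfDualLattice_stdLattice_three_of_v hϖ⟩}).ncard = Nat.card 𝓀[K] := by
      rw [Set.ncard_sdiff_singleton_of_mem hvmem, hstar, Nat.add_sub_cancel]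
    have hsub : {w | w ∈ S ∧ w.1 ≠ mapGL (u : GL (Fin 3) K) (stdLattice K 3) ∧ mapGL (γ : GL (Fin 3) K) w.1 = w.1} ⊆
        S \ {latticeGraphIso σ ϖ ((StdForm.antidiagonal 3).over K) u ⟨stdLattice K 3, 0, isSelfDualLattice_stdLattice_three_of_v hϖ⟩} := by
      rintro w' ⟨hw'S, hne', -⟩
      refine ⟨hw'S, fun heq => hne' ?_⟩
      rw [Set.mem_singleton_iff] at heq
      rw [heq, latticeGraphIso_apply_val]
    have heq := Set.eq_of_subset_of_ncard_le hsub (by rw [hpunct, hcount]) (hfin.subset Set.sdiff_subset)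
    have hwmem : w ∈ S \ {latticeGraphIso σ ϖ ((StdForm.antidiagonal 3).over K) u ⟨stdLattice K 3, 0, isSelfDualLattice_stdLattice_three_of_v hϖ⟩} := by
      refine ⟨hw, fun heq' => hwv ?_⟩
      rw [Set.mem_singleton_iff] at heq'
      rw [heq', latticeGraphIso_apply_val]
    rw [← heq] at hwmem
    exact hwmem.2.2

/-- **ALL OR NONE at a general vertex**: through a modular neighbour `(uκ)·N₁` of `v = u·L₀` (deep `γ`, `γ′ = u⁻¹γu ∈ K₀`), either every adjacent vertex is fixed by `γ`,
or no self-dual `w ≠ v` adjacent to it is. [cite: Tits1979, §3.5] [cite: Serre1980Trees, II.1.1] -/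
theorem forall_mapGL_eq_self_or_forall_ne_latticeGraphIso_of_congr (hvσ : ∀ a, Valued.v (σ a) = Valued.v a) (hσϖ : σ ϖ = -ϖ)
    (hϖ : Valued.v ϖ = WithZero.exp (-1 : ℤ)) (hres : ∀ x : K, Valued.v x ≤ 1 → Valued.v (σ x - x) < 1) [Finite 𝓀[K]]
    {γ u κ : unitaryGroupOfForm σ ((StdForm.antidiagonal 3).over K)}
    (hγK : u⁻¹ * γ * u ∈ unitaryInt σ ((StdForm.antidiagonal 3).over K)) (hκK : κ ∈ unitaryInt σ ((StdForm.antidiagonal 3).over K))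
    (hγϖ : ∀ i j, Valued.v (((((u⁻¹ * γ * u : unitaryGroupOfForm σ ((StdForm.antidiagonal 3).over K)) : GL (Fin 3) K) : Matrix (Fin 3) (Fin 3) K) - 1) i j) ≤ Valued.v ϖ) :
    (∀ w ∈ (latticeGraph σ ϖ ((StdForm.antidiagonal 3).over K)).neighborSet
          (latticeGraphIso σ ϖ ((StdForm.antidiagonal 3).over K) (u * κ) ⟨latt (Matrix.diagonal ![(1 : K), 1, ϖ]), 2, isVertexLattice_two_N₁_of_neg hσϖ hϖ⟩),
        mapGL (γ : GL (Fin 3) K) w.1 = w.1) ∨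
    (∀ w ∈ (latticeGraph σ ϖ ((StdForm.antidiagonal 3).over K)).neighborSet
          (latticeGraphIso σ ϖ ((StdForm.antidiagonal 3).over K) (u * κ) ⟨latt (Matrix.diagonal ![(1 : K), 1, ϖ]), 2, isVertexLattice_two_N₁_of_neg hσϖ hϖ⟩),
        w.1 ≠ mapGL (u : GL (Fin 3) K) (stdLattice K 3) → mapGL (γ : GL (Fin 3) K) w.1 ≠ w.1) := by
  by_cases hex : ∃ w ∈ (latticeGraph σ ϖ ((StdForm.antidiagonal 3).over K)).neighborSet
          (latticeGraphIso σ ϖ ((StdForm.antidiagonal 3).over K) (u * κ) ⟨latt (Matrix.diagonal ![(1 : K), 1, ϖ]), 2, isVertexLattice_two_N₁_of_neg hσϖ hϖ⟩),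
        w.1 ≠ mapGL (u : GL (Fin 3) K) (stdLattice K 3) ∧ mapGL (γ : GL (Fin 3) K) w.1 = w.1
  · exact Or.inl fun w hw => forall_mapGL_eq_self_of_exists_fixed_child_latticeGraphIso_of_congr hvσ hσϖ hϖ hres hγK hκK hγϖ hex hw
  · push Not at hex
    exact Or.inr fun w hw hne => hex w hw hne

end Literature.NumberTheory.Automorphic.UnitaryLatticeTree

end
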